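import Summits.CriticalPhenomena.PercolationContinuityZ3.Theorems.PercNearOneGluingNoHeavyLowerTailSahiQuantC3Cumulation
import Literature.Combinatorics.Sahi2008.Percolation

/-!
# `NoHeavyLowerTail` (crux stmt-CriticalPhenomena-4575), Sahi programme: the quantitative `C₃` IN PERCOLATION VOCABULARY —
# `2·E₃({S ⊆ ω}, {T ⊆ ω}, {U ⊆ ω}) ≥ P(S ∪ T ∪ U open) − P(S open)P(T open)P(U open)` for three CYLINDER events under `prodBernoulli p`

Support file (Sahi cell, seat `prim-sahi-p1`, generation 48; `--supports stmt-CriticalPhenomena-4575`).  Pure proofs, NO definitions, no `sorry`,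
standard axioms.  Part 4 of the quantitative-`C₃` files: the measure-level corollary of `SahiQuantC3.two_mul_sahiE_three_principal_ge` (three principal
up-sets, every FKG weight) for the product measure `prodBernoulli p` on `Set ι` and the cylinder events 'every element (edge) of `S` is open',
`{ω | S ⊆ ω}` = the principal up-set `↑S` of the Boolean lattice `Set ι` — the case prim-sahi-p2 asked about ('{0,1}^m').  With the event functional
`sahiE3` of `Literature.Probability.LatticeModels` (`E₃(A,B,C) = 2μ(ABC) + μ(A)μ(B)μ(C) − Σ μ(A)μ(BC)`):

  **`two_mul_sahiE3_cylinders_ge`.**  `μ(↑S ∩ ↑T ∩ ↑U) − μ(↑S)μ(↑T)μ(↑U) ≤ 2 · sahiE3 μ ↑S ↑T ↑U`,  `μ = prodBernoulli p`, any `S, T, U ⊆ ι`.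

Since `↑S ∩ ↑T ∩ ↑U = ↑(S ∪ T ∪ U)` the left side is `Π_{e ∈ S∪T∪U} p_e − Π_{e∈S} p_e Π_{e∈T} p_e Π_{e∈U} p_e` (not expanded here).  The constant `2` is
sharp (`…SahiQuantC3Principal.two_mul_latticeE3_self_sub`); for general increasing events (e.g. connections) no such constant exists on the lattice side, and for
the percolation target K_avg (three connection events) the analogous hypothesis — conditional Harris given a connection — fails (memo
FROM-prim-sahi-p1-gen48-TANGENT-WIDTH-TWO §5: the 4-cycle). [this work]
-/

namespace Summit.CriticalPhenomena.PercolationContinuityZ3.Theorems.SahiQuantC3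

open Finset MeasureTheory Literature.Probability.LatticeModels Literature.Combinatorics.Sahi2008
open Literature.Probability.Percolation.DecisionTree (ind ind_of_mem ind_of_not_mem)
open scoped BigOperators

noncomputable section

variable {ι : Type*} [Fintype ι]

/-- The principal up-set `↑S` of the Boolean lattice `Set ι` has indicator `ind {ω | S ⊆ ω}`. [this work] -/
theorem setInd_principalUp_eq_ind [DecidableEq (Set ι)] [DecidableLE (Set ι)] (S : Set ι) :
    setInd (principalUp S) = ind {ω : Set ι | S ⊆ ω} := by
  funext ω
  rw [setInd_apply]
  by_cases h : S ⊆ ω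
  · have hm : ω ∈ principalUp S := mem_principalUp.2 h
    rw [if_pos hm, ind_of_mem (by exact h)]
  · have hm : ω ∉ principalUp S := fun hm => h (mem_principalUp.1 hm)
    rw [if_neg hm, ind_of_not_mem (by exact h)]

/-- **THE QUANTITATIVE `C₃` FOR THREE CYLINDER EVENTS UNDER A PRODUCT MEASURE.**  For `μ = prodBernoulli p` on `Set ι` and any `S, T, U ⊆ ι`,
with `↑S = {ω | S ⊆ ω}` ('all of `S` open'): `μ(↑S ∩ ↑T ∩ ↑U) − μ(↑S)μ(↑T)μ(↑U) ≤ 2 · sahiE3 μ ↑S ↑T ↑U`. [this work] -/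
theorem two_mul_sahiE3_cylinders_ge (p : ι → unitInterval) (S T U : Set ι) :
    (prodBernoulli p).real ({ω : Set ι | S ⊆ ω} ∩ {ω | T ⊆ ω} ∩ {ω | U ⊆ ω})
        - (prodBernoulli p).real {ω : Set ι | S ⊆ ω} * (prodBernoulli p).real {ω : Set ι | T ⊆ ω}
          * (prodBernoulli p).real {ω : Set ι | U ⊆ ω} ≤
      2 * sahiE3 (prodBernoulli p) {ω : Set ι | S ⊆ ω} {ω | T ⊆ ω} {ω | U ⊆ ω} := by
  classical
  have h := two_mul_sahiE_three_principal_ge' (α := Set ι) (isFKGMeasure_bernoulliWeight p) S T U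
  -- products of event indicators are indicators of intersections (the tree's `ind_mul_ind_mul_ind_eq_inter`, restated locally to keep imports light)
  have hind : ∀ A B C : Set (Set ι), ind A * ind B * ind C = ind (A ∩ B ∩ C) := by
    intro A B C
    funext ω
    simp only [Pi.mul_apply]
    by_cases hA : ω ∈ A <;> by_cases hB : ω ∈ B <;> by_cases hC : ω ∈ C <;>
      simp [ind_of_mem, ind_of_not_mem, hA, hB, hC, Set.mem_inter_iff]
  rw [setInd_principalUp_eq_ind, setInd_principalUp_eq_ind, setInd_principalUp_eq_ind, hind,
    ex_bernoulliWeight_ind, ex_bernoulliWeight_ind, ex_bernoulliWeight_ind, ex_bernoulliWeight_ind, sahiE_three_ind] at h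
  exact h

end

end Summit.CriticalPhenomena.PercolationContinuityZ3.Theorems.SahiQuantC3
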